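import Summits.ABC.StewartYu.PadicG3SatNPackB
import Summits.ABC.StewartYu.PadicG3ParNBudgetA
import Summits.ABC.StewartYu.PadicG3ExpLine
import HarnessLib

/-!
# Cell abc-stewartyu, WP-L.P(odd) (crux r3 `PadicCoreOddRat`, stmt-ABC-20503): the SMALLNESS EXPONENT of the saturated odd-`p` frame
# from the record's headline — datum transfer `W⁺(W̃) ≤ 4ⁿ·W⁺(W)` and `U := E·log p`

`Summits/ABC/StewartYu/PadicG3SatNExp.lean` — cell `abc-stewartyu` (seat p2-g7, line lead of `sat-odd`; record owner p1 g11).  Proofs only;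
no definition, no named fact.  The record package of `G3Setup.recordSupplyOddSatRD_of_package'` (`PadicG3SatNPackB`) asks for a smallness
`‖Λ/b̃_{k₀}‖ ≤ e^{−U}` whose order `U` dominates the four budget lines.  As for crux `Y07Odd` (`PadicG3ExpLineP.expLine_V`), `U := E·log p`
with `E := ⌈B/log p⌉` is read off the NEGATED crux bound once the record's HEADLINE `2·B ≤ c_h^n·(p/log p)·Ω·W⁺` is known
(`PadicG3ExpLine.expLine_budget`).  Two things are new in the saturated frame and are settled here, on the frame side:
* the record's coefficient letter is the budget letter `P.W = W̃ ≤ W + log N + log n! + 4·log n` (directions `b̃ = bo ᵥ* C`, index `N`),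
  not the datum's `W`; since `N ≤ ∏ⱼ 2Vⱼ/log 2` the headline's logarithm transfers to the datum's at the cost `4ⁿ`:
  `W⁺(P) = W̃ + log p + log 2Amax ≤ 4ⁿ·(W + log p + log 2Vmax)` (`PadicG3Par.Wp_le_four_pow_mul`), so a headline with constant `c_h`
  serves the crux constant `c ≥ 4·c_h`;
* `W̃ + log p ≤ Zp` at every `m` (`PadicG3Par.W_add_log_le_Zp'`, from `W̃ ≤ W_LV ≤ Zp/128`, `log p ≤ 2G ≤ Zp/2³¹` under `½ ≤ θ₀`), so any
  budget `B ≥ Zp` is admissible for `expLine_budget`.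
Main: `G3Setup.expLine_satN` — `∃ E ≥ 1`, `‖Λ/b̃_{k₀}‖ ≤ (p^E)⁻¹`, `B ≤ E·log p ≤ B + log p`.

References: K. Yu, Acta Math. 211 (2013) §7; Yu. V. Nesterenko, LNM 1819 (2003) §4.2 (shape only).
-/

noncomputable section

open Finset Real

namespace Summit.ABC.StewartYu

namespace PadicG3Par

variable {n : ℕ} (P : PadicG3Par n)

/-- `n² + 4n + 2 ≤ 2·4ⁿ` for `n ≥ 1`. [folklore] -/
theorem sq_add_le_two_mul_four_pow {k : ℕ} (hk : 1 ≤ k) : (k : ℝ) ^ 2 + 4 * k + 2 ≤ 2 * 4 ^ k := by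
  induction k with
  | zero => omega
  | succ j ih =>
    rcases Nat.eq_zero_or_pos j with hj | hj
    · subst hj; norm_num
    · have h := ih hj
      have hj1 : (1 : ℝ) ≤ j := by exact_mod_cast hj
      push_cast
      have e : (4 : ℝ) ^ (j + 1) = 4 * 4 ^ j := by rw [pow_succ]; ring
      rw [e]
      nlinarith

/-- **DATUM TRANSFER OF THE HEADLINE'S LOGARITHM**: if the record's coefficient letter is the saturated frame's budget letter
`P.W ≤ W + log N + log n! + 4·log n` with `N ≤ ∏ⱼ 2Vⱼ/log 2`, `P.A = V`, `P.Amax ≤ Vmax`, then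
`W⁺(P) = P.W + log p + log 2Amax ≤ 4ⁿ·(W + log p + log 2Vmax)`. [folklore] -/
theorem Wp_le_four_pow_mul {V : Fin n → ℝ} {Vmax W : ℝ} {N : ℕ} (hAmaxV : P.Amax ≤ Vmax)
    (hV1 : ∀ j, 1 ≤ V j) (hVm : ∀ j, V j ≤ Vmax) (hW1 : 1 ≤ W) (hN : 1 ≤ N)
    (hNV : (N : ℝ) ≤ ∏ j, (2 * V j / Real.log 2))
    (hPW : P.W ≤ W + Real.log N + Real.log n.factorial + 4 * Real.log n) :
    P.Wp ≤ 4 ^ n * (W + Real.log P.p + Real.log (2 * Vmax)) := by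
  have hn := P.hn
  have hnR : (1 : ℝ) ≤ n := by exact_mod_cast hn
  have hlogN : Real.log N ≤ 2 * n * Real.log (2 * Vmax) := G3Setup.log_N_le_of_prod hN hV1 hVm hNV
  have hVmax : 1 ≤ Vmax := le_trans (hV1 ⟨0, hn⟩) (hVm ⟨0, hn⟩)
  have hl2 : (0.6931471803 : ℝ) < Real.log 2 := Real.log_two_gt_d9
  have hL2 : Real.log 2 ≤ Real.log (2 * Vmax) := Real.log_le_log two_pos (by linarith)
  have hlp : Real.log 2 ≤ Real.log P.p := P.log_two_le_log_p
  have hA1 := P.hAmax1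
  have hAm : Real.log (2 * P.Amax) ≤ Real.log (2 * Vmax) := Real.log_le_log (by linarith) (by linarith)
  -- `log n ≤ n − 1`, `log n! ≤ n·(n − 1)`
  have hlogn : Real.log n ≤ (n : ℝ) - 1 := Real.log_le_sub_one_of_pos (by linarith)
  have hlogfact : Real.log (n.factorial : ℝ) ≤ n * ((n : ℝ) - 1) := by
    have h1 : (n.factorial : ℝ) ≤ (n : ℝ) ^ n := by exact_mod_cast Nat.factorial_le_pow n
    have hfa : (0 : ℝ) < n.factorial := by exact_mod_cast n.factorial_pos
    calc Real.log (n.factorial : ℝ) ≤ Real.log ((n : ℝ) ^ n) := Real.log_le_log hfa h1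
      _ = n * Real.log n := by rw [Real.log_pow]
      _ ≤ n * ((n : ℝ) - 1) := mul_le_mul_of_nonneg_left hlogn (by linarith)
  have h4 := sq_add_le_two_mul_four_pow hn
  -- the datum logarithm `D ≥ 2`
  set D : ℝ := W + Real.log P.p + Real.log (2 * Vmax) with hD
  have hD2 : 2 ≤ D := by rw [hD]; linarith
  have hLD : Real.log (2 * Vmax) ≤ D - 1.69 := by rw [hD]; linarith
  unfold Wp
  -- `Wp ≤ D + 2n·log 2Vmax + n(n−1) + 4(n−1) ≤ (2n+1)·D + n² − 0.38n − 4 ≤ (n²/2 + 2n + 1)·D ≤ 4ⁿ·D`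
  have h1 : P.W + Real.log P.p + Real.log (2 * P.Amax) ≤ D + 2 * n * Real.log (2 * Vmax) + n * ((n : ℝ) - 1) + 4 * ((n : ℝ) - 1) := by
    rw [hD]; nlinarith
  have h2 : 2 * (n : ℝ) * Real.log (2 * Vmax) ≤ 2 * n * D - 3.38 * n := by nlinarith
  have h3 : (n : ℝ) * ((n : ℝ) - 1) + 4 * ((n : ℝ) - 1) - 3.38 * n ≤ (n : ℝ) ^ 2 / 2 * D := by nlinarith
  have h5 : ((n : ℝ) ^ 2 / 2 + 2 * n + 1) * D ≤ 4 ^ n * D := by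
    have : (n : ℝ) ^ 2 / 2 + 2 * n + 1 ≤ 4 ^ n := by linarith
    exact mul_le_mul_of_nonneg_right this (by linarith)
  nlinarith

/-- **`P.W + log p ≤ Zp`** at every `m` under `½ ≤ θ₀` (`W ≤ W_LV − 1 ≤ Zp/128`, `log p ≤ 2G ≤ Zp/2³¹`). [folklore] -/
theorem W_add_log_le_Zp' (hθ : 1 / 2 ≤ P.θ₀) : P.W + Real.log P.p ≤ P.Zp := by
  have h1 := P.W_add_log_le_WLV
  have h2 := P.WLV_le_Zp
  have h3 := P.log_p_le_two_G hθ
  have h4 := P.tinyV.1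
  have hZ := P.Zp_facts.1
  have hLV := P.one_le_LV
  have hlog : 0 ≤ Real.log (2 * (P.LV : ℝ)) := Real.log_nonneg (by linarith)
  nlinarith

end PadicG3Par

namespace G3Setup

variable {p : ℕ} [Fact p.Prime] (S : G3Setup p)

/-- **THE SMALLNESS EXPONENT OF THE SATURATED ODD-`p` FRAME.**  From the negated crux bound at the datum `(αo, bo, V, Vmax, W)` with
constant `c`, a record `P` on the budget letter `P.W ≤ W + log N + log n! + 4 log n` (`P.A = V`, `P.Amax ≤ Vmax`, `½ ≤ θ₀`) whose
directions satisfy `log max(3,|b̃ₖ|) ≤ P.W`, and a HEADLINE `2·B ≤ c_h^n·(p/log p)·Ω·W⁺(P)` with `4·c_h ≤ c` and `Zp ≤ B`: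
an exponent `E ≥ 1` with `‖Λ/b̃_{k₀}‖ ≤ (p^E)⁻¹` and `B ≤ E·log p ≤ B + log p`. [cite: Yu2013, §7; shape only] -/
theorem expLine_satN (F : S.SatData) (P : PadicG3ParN S.n) (V : Fin S.n → ℝ) (Vmax W : ℝ)
    (hV1 : ∀ j, 1 ≤ V j) (hVm : ∀ j, V j ≤ Vmax) (hW1 : 1 ≤ W)
    (hNV : (F.N : ℝ) ≤ ∏ j, (2 * V j / Real.log 2))
    {c : ℝ} (hneg : ¬ (padicValRat p (∏ j, F.αo j ^ F.bo j - 1) : ℝ) * Real.log p ≤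
        c ^ S.n * ((p : ℝ) / Real.log p) * (∏ j, V j) * (W + Real.log p + Real.log (2 * Vmax)))
    (hPp : P.p = p) (hPA : P.A = V) (hAmaxV : P.Amax ≤ Vmax) (hθ : (1 / 2 : ℝ) ≤ P.θ₀)
    (hPW : P.W ≤ W + Real.log F.N + Real.log S.n.factorial + 4 * Real.log S.n)
    (hbW : ∀ k, Real.log (max 3 (|S.b k| : ℝ)) ≤ P.W)
    {ch B : ℝ} (hch : 0 ≤ ch) (hc : 4 * ch ≤ c)
    (hhead : 2 * B ≤ ch ^ S.n * ((P.p : ℝ) / Real.log P.p) * P.Ω * P.Wp) (hB : P.Zp ≤ B) :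
    ∃ E : ℕ, 1 ≤ E ∧ ‖S.Λ / (S.b S.j₀ : ℚ_[p])‖ ≤ ((p : ℝ) ^ E)⁻¹ ∧ B ≤ (E : ℝ) * Real.log p ∧
      (E : ℝ) * Real.log p ≤ B + Real.log p := by
  have hp : p.Prime := Fact.out
  have hp1 : (1 : ℝ) < p := by exact_mod_cast hp.one_lt
  have hlogp : 0 < Real.log p := Real.log_pos hp1
  have hprodV : 0 ≤ ∏ j, V j := prod_nonneg fun j _ => le_trans zero_le_one (hV1 j)
  -- the negated bound in the frame's letters `θ = S.α`, `b̃ = S.b`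
  set R : ℝ := c ^ S.n * ((p : ℝ) / Real.log p) * (∏ j, V j) * (W + Real.log p + Real.log (2 * Vmax)) with hR
  have hnegS : ¬ (padicValRat p (∏ j, S.α j ^ S.b j - 1) : ℝ) * Real.log p ≤ R := by
    rw [F.prod_zpow_b_eq]; exact hneg
  -- the headline's right side is at most `R`
  have hΩ : P.Ω = ∏ j, V j := by unfold PadicG3Par.Ω; rw [hPA]
  have hWp : P.Wp ≤ 4 ^ S.n * (W + Real.log P.p + Real.log (2 * Vmax)) :=
    P.Wp_le_four_pow_mul hAmaxV hV1 hVm hW1 F.hN hNV hPW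
  rw [hPp] at hWp
  have hD0 : 0 ≤ W + Real.log p + Real.log (2 * Vmax) := by
    have hn := P.hn
    have hVmax : 1 ≤ Vmax := le_trans (hV1 ⟨0, hn⟩) (hVm ⟨0, hn⟩)
    have : 0 ≤ Real.log (2 * Vmax) := Real.log_nonneg (by linarith)
    linarith
  have hpre : 0 ≤ ch ^ S.n * ((p : ℝ) / Real.log p) * (∏ j, V j) := by positivity
  have hstep1 : ch ^ S.n * ((P.p : ℝ) / Real.log P.p) * P.Ω * P.Wp ≤
      ch ^ S.n * ((p : ℝ) / Real.log p) * (∏ j, V j) * (4 ^ S.n * (W + Real.log p + Real.log (2 * Vmax))) := by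
    rw [hΩ, hPp]
    exact mul_le_mul_of_nonneg_left hWp hpre
  have hpow : (4 * ch) ^ S.n ≤ c ^ S.n := pow_le_pow_left₀ (by positivity) hc S.n
  have hstep2 : ch ^ S.n * ((p : ℝ) / Real.log p) * (∏ j, V j) * (4 ^ S.n * (W + Real.log p + Real.log (2 * Vmax))) =
      (4 * ch) ^ S.n * (((p : ℝ) / Real.log p) * (∏ j, V j) * (W + Real.log p + Real.log (2 * Vmax))) := by
    rw [mul_pow]; ring
  have hX0 : 0 ≤ ((p : ℝ) / Real.log p) * (∏ j, V j) * (W + Real.log p + Real.log (2 * Vmax)) := by positivity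
  have hstep3 : (4 * ch) ^ S.n * (((p : ℝ) / Real.log p) * (∏ j, V j) * (W + Real.log p + Real.log (2 * Vmax))) ≤ R := by
    rw [hR]
    have := mul_le_mul_of_nonneg_right hpow hX0
    linarith
  have hB2 : 2 * B ≤ R := by linarith
  -- `P.W + log p ≤ B`
  have hWB : P.W + Real.log p ≤ B := by
    have h := P.W_add_log_le_Zp' hθ
    rw [hPp] at h
    linarith
  exact S.expLine_budget hbW hnegS hB2 hWB

end G3Setup

end Summit.ABC.StewartYu

end
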